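import Summits.QuantumFields.YangMills.Theorems.BalabanLadderNTSubsequentialUnitTransfer
import Summits.QuantumFields.YangMills.Theorems.BalabanLadderNTSubsequentialBridge
import HarnessLib

/-!
# Crux `NT` (stmt-QuantumFields-19353): NT CALIBRATES THE UNIT ONLY UP TO BOUNDED β-DEPENDENT FACTORS —
# given the collar bound, NT's floors at unit `a` feed the summit bridge at ANY comparable unit `a'`

Helper file (`--supports stmt-QuantumFields-19353`) of the fleet lead prover of crux `NT` (unit `ym-spine-19353-p1`, g29),
hypothesis-free; capstone of the g29 series `…NTSubsequential{Nontrivial, Growth, Bridge, Windows, CompactFamily, UnitSums,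
UnitModulus}`.  The route `BalabanLadder` asks the four lattice legs «in the SAME units `(r, a)`», with `NT` the calibrating
leg (`∃ (r, a)`); the tree's `UVSeamRec.UnitDilation.lowerBounds_const_mul_iff` shows the unit matters only up to a CONSTANT
factor.  This file shows that, as far as the deciding bridge is concerned, it matters only up to BOUNDED β-DEPENDENT factors:

* (`…NTSubsequentialUnitTransfer`: geometry, collar algebra, the unit modulus `exists_unit_modulus`);
* §2 **`subseqFloors_of_comparableUnit`** — let `MomentBounds G r a'` (the UV leg's collar bound, at the TARGET unit) hold, let
  NT's two floors hold in the subsequential form at unit `a` on a cofinal set `Bset` with compactly supported witnesses (`v` with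
  a time gap `δ₀ > 0`; `f, g, h` pairwise at distance `≥ δ > 0`), and let `m₁ ≤ a β / a' β ≤ m₂` on `Bset` (`m₁ > 0`), `a → 0`.
  Then for ONE dilation `D = μ • id`, `μ ∈ [m₁, m₂]`, the dilated witnesses `v∘D, f∘D, g∘D, h∘D` carry both floors (halved)
  at unit `a'` in the subsequential form on a cofinal `Bset' ⊆ Bset`.  Mechanism: at each good `β` the exact dilation covariance
  (`Q2_theta_compCLM`, `Q3_compCLM`) moves the floor to unit `a'` with the β-DEPENDENT dilate `μ(β) = aβ/a'β`; the collar bound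
  makes both functionals Lipschitz in `μ` uniformly (`abs_Q2_dilate_sub_le`, `abs_Q3_dilate_sub_le` with collar radius
  `R ≍ κ/a'β`); Bolzano–Weierstrass + the modulus (`subseq_of_locLipschitzFamily`) freeze `μ`;
* §3 **`yangMills_of_legs_comparableUnits`** — `YangMills ⇐ ∀ G simple ∃ r a a' Bset …`: `UV`, `ROT`, and IR on `Bset` at unit
  `a'`; NT's subsequential floors at unit `a` (compactly supported, gapped / separated witnesses); `a'/a` bounded above and below
  on `Bset`.  I.e. the non-triviality scale need only be COMPARABLE to the unit in which the other legs are delivered (e.g. the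
  two-loop unit of record of `UVSeamRec`), not equal to it.

HONEST FRAMING: bookkeeping over the tree bridge + finite-torus analysis; every leg is a HYPOTHESIS; `NT`, the seam, the gap and
`YangMills` are NOT proved; not Clay. [folklore]
-/

set_option autoImplicit false

noncomputable section

open scoped SchwartzMap
open MeasureTheory Filter Topology Set
open Literature.MathematicalPhysics.QuantumFieldTheory Literature.MathematicalPhysics.QuantumLattice
open Literature.Probability.LatticeModels
open Summit.QuantumFields.YangMills.Cruxes.OSLegsFromFemtoAndGap.DlrCollarTransfer
open Summit.QuantumFields.YangMills.Cruxes.UVSeamRec.UnitDilation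
  (Q2_theta_compCLM Q3_compCLM exists_dilation tsupport_compCLM_subset_pos disjoint_tsupport_compCLM)

namespace Summit.QuantumFields.YangMills.Cruxes.NT.Subsequential

/-! ## §2 The transfer of the floors to a comparable unit -/

section Transfer

variable {G : Type} [Group G] [TopologicalSpace G] [IsTopologicalGroup G] [CompactSpace G]
  [MeasurableSpace G] [BorelSpace G]

/-- **NT's floors at unit `a` feed the bridge at any comparable unit `a'`, given the collar bound at `a'`.**  From
`MomentBounds G r a'`, the subsequential floors at unit `a` on a cofinal set `Bset` with compactly supported witnesses (`v`
gapped by `δ₀ > 0`, `f, g, h` pairwise `δ`-separated), `a → 0` and `m₁ ≤ aβ/a'β ≤ m₂` on `Bset` (`m₁ > 0`): ONE dilation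
`D = μ • id`, `μ ∈ [m₁, m₂]`, makes `v∘D, f∘D, g∘D, h∘D` carry both floors (halved) at unit `a'`, on a cofinal `Bset' ⊆ Bset`,
at each coupling on tori of unbounded size. [folklore] -/
theorem subseqFloors_of_comparableUnit (r : LatticeRep G) {a a' : ℝ → ℝ} (ha'pos : ∀ β, 0 < a' β)
    (hlim : Tendsto a atTop (𝓝 0)) (hMB : MomentBounds G r a')
    {Bset : Set ℝ} (hBcof : ∀ x : ℝ, ∃ β ∈ Bset, x ≤ β) {m₁ m₂ : ℝ} (hm₁ : 0 < m₁)
    (hratio : ∀ β ∈ Bset, m₁ ≤ a β / a' β ∧ a β / a' β ≤ m₂)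
    {v f g h : 𝓢(EuclideanSpace ℝ (Fin 4), ℝ)} {σ δ₀ δ : ℝ} (hσ : 0 < σ)
    (hvσ : tsupport (v : EuclideanSpace ℝ (Fin 4) → ℝ) ⊆ Metric.closedBall 0 σ)
    (hfσ : tsupport (f : EuclideanSpace ℝ (Fin 4) → ℝ) ⊆ Metric.closedBall 0 σ)
    (hgσ : tsupport (g : EuclideanSpace ℝ (Fin 4) → ℝ) ⊆ Metric.closedBall 0 σ)
    (hhσ : tsupport (h : EuclideanSpace ℝ (Fin 4) → ℝ) ⊆ Metric.closedBall 0 σ)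
    (hδ₀ : 0 < δ₀) (hv0 : ∀ p : EuclideanSpace ℝ (Fin 4), v p ≠ 0 → δ₀ ≤ p 0) (hδ : 0 < δ)
    (hfg : ∀ p q : EuclideanSpace ℝ (Fin 4), f p ≠ 0 → g q ≠ 0 → δ ≤ ‖p - q‖)
    (hgh : ∀ p q : EuclideanSpace ℝ (Fin 4), g p ≠ 0 → h q ≠ 0 → δ ≤ ‖p - q‖)
    (hfh : ∀ p q : EuclideanSpace ℝ (Fin 4), f p ≠ 0 → h q ≠ 0 → δ ≤ ‖p - q‖)
    {ε ε' : ℝ} (hε : 0 < ε) (hε' : 0 < ε')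
    (hfl : ∀ β ∈ Bset, ∀ Dd : ℕ, ∃ L : ℕ, Dd ≤ L ∧
      ε ≤ Q2 G r β L (a β) (thetaTest 4 v) v ∧ ε' ≤ |Q3 G r β L (a β) f g h|) :
    ∃ μ ∈ Icc m₁ m₂, ∃ D : EuclideanSpace ℝ (Fin 4) ≃L[ℝ] EuclideanSpace ℝ (Fin 4), (∀ x, D x = μ • x) ∧
      ∃ Bset' : Set ℝ, Bset' ⊆ Bset ∧ (∀ x : ℝ, ∃ β ∈ Bset', x ≤ β) ∧
        ∀ β ∈ Bset', ∀ Dd : ℕ, ∃ L : ℕ, Dd ≤ L ∧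
          ε / 2 ≤ Q2 G r β L (a' β) (thetaTest 4 (SchwartzMap.compCLMOfContinuousLinearEquiv ℝ D v))
            (SchwartzMap.compCLMOfContinuousLinearEquiv ℝ D v) ∧
          ε' / 2 ≤ |Q3 G r β L (a' β) (SchwartzMap.compCLMOfContinuousLinearEquiv ℝ D f)
            (SchwartzMap.compCLMOfContinuousLinearEquiv ℝ D g) (SchwartzMap.compCLMOfContinuousLinearEquiv ℝ D h)| := by
  -- `m₁ ≤ m₂`
  obtain ⟨β₀, hβ₀, -⟩ := hBcof 0
  have hm₁₂ : m₁ ≤ m₂ := (hratio β₀ hβ₀).1.trans (hratio β₀ hβ₀).2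
  obtain ⟨Mod, η₀, s₀, β₄, Dm, hMod, hη₀, hs₀, HMOD⟩ :=
    exists_unit_modulus r ha'pos hMB hσ hvσ hfσ hgσ hhσ hδ₀ hv0 hδ hfg hgh hfh hm₁ hm₁₂
  -- the smallness `a' β ≤ s₀` holds on `Bset` past a threshold (`a' ≤ a/m₁` there and `a → 0`)
  obtain ⟨B₁, hB₁⟩ : ∃ B₁ : ℝ, ∀ β, B₁ ≤ β → a β < m₁ * s₀ :=
    Filter.eventually_atTop.1 (hlim.eventually (gt_mem_nhds (by positivity)))
  set Bset₀ : Set ℝ := Bset ∩ Ici (max β₄ B₁) with hBset₀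
  have hcof₀ : ∀ x : ℝ, ∃ β ∈ Bset₀, x ≤ β := by
    intro x
    obtain ⟨β, hβ, hxβ⟩ := hBcof (max x (max β₄ B₁))
    exact ⟨β, ⟨hβ, mem_Ici.2 ((le_max_right _ _).trans hxβ)⟩, (le_max_left _ _).trans hxβ⟩
  have hsmall : ∀ β ∈ Bset₀, a' β ≤ s₀ := by
    rintro β ⟨hβ, hβ'⟩
    have hr := (hratio β hβ).1
    rw [le_div_iff₀ (ha'pos β)] at hr
    have h1 := hB₁ β ((le_max_right _ _).trans (mem_Ici.1 hβ'))
    nlinarith [ha'pos β]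
  have hβ₄ : ∀ β ∈ Bset₀, β₄ ≤ β := fun β hβ => (le_max_left _ _).trans (mem_Ici.1 hβ.2)
  -- compactness + modulus
  obtain ⟨μ, hμI, Bset', hsub, hcof', hfl'⟩ := subseq_of_locLipschitzFamily hcof₀
    (fun β L μ => Q2 G r β L (μ * a' β) (thetaTest 4 v) v) (fun β L μ => |Q3 G r β L (μ * a' β) f g h|)
    (fun β => a β / a' β) (fun β hβ => hratio β hβ.1) hε hε' hMod hη₀ Dm
    (fun β hβ Dd => by
      obtain ⟨L, hL, h2, h3⟩ := hfl β hβ.1 Dd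
      have e : a β / a' β * a' β = a β := div_mul_cancel₀ (a β) (ha'pos β).ne'
      refine ⟨L, hL, ?_, ?_⟩
      · simpa only [e] using h2
      · simpa only [e] using h3)
    (fun β hβ L hL μ hμ ν hν _ => (HMOD β (hβ₄ β hβ) (hsmall β hβ) L hL μ hμ ν hν).1)
    (fun β hβ L hL μ hμ ν hν hclose => (HMOD β (hβ₄ β hβ) (hsmall β hβ) L hL μ hμ ν hν).2 hclose)
  have hμ0 : 0 < μ := hm₁.trans_le hμI.1
  obtain ⟨D, hD⟩ := exists_dilation μ hμ0.ne'
  refine ⟨μ, hμI, D, hD, Bset', hsub.trans Set.inter_subset_left, hcof', fun β hβ Dd => ?_⟩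
  obtain ⟨L, hL, h2, h3⟩ := hfl' β hβ Dd
  refine ⟨L, hL, ?_, ?_⟩
  · rw [Q2_theta_compCLM D μ hD r β L (a' β) v]; exact h2
  · rw [Q3_compCLM D μ hD r β L (a' β) f g h]; exact h3

end Transfer

/-! ## §3 The summit from legs in COMPARABLE units -/

/-- **`YangMills ⇐` UV, ROT, IR at unit `a'` and NT's (subsequential, compactly witnessed) floors at a COMPARABLE unit `a`.**
For every compact simple `G`: SOME `r`, positive units `a, a' → 0`, a cofinal coupling set `Bset` with `m₁ ≤ aβ/a'β ≤ m₂`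
there, `UV G r a'`, `ROT G r a'`, the `GapInUnits` family on `Bset` at unit `a'`, and NT's two floors at unit `a` on `Bset`
(tori of unbounded size) with compactly supported witnesses (`v` gapped, `f, g, h` pairwise separated) — give the tree's
`_root_.YangMills`.  (Collar bound `MomentBounds G r a'` from `UV` by `momentBounds_of_momentBounds6`; transfer by
`subseqFloors_of_comparableUnit`; bridge `Y2Bridge.yangMills_of_subseqNTLegs`.) [folklore] -/
theorem yangMills_of_legs_comparableUnits
    (hyp : ∀ (G : Type) [Group G] [TopologicalSpace G] [IsTopologicalGroup G] [CompactSpace G],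
      IsCompactSimpleLieGroup G → letI : MeasurableSpace G := borel G; haveI : BorelSpace G := ⟨rfl⟩;
      ∃ (r : LatticeRep G) (a a' : ℝ → ℝ) (m₁ m₂ σ δ₀ δ ε ε' : ℝ) (Bset : Set ℝ)
        (v f g h : 𝓢(EuclideanSpace ℝ (Fin 4), ℝ)),
        (∀ β, 0 < a β) ∧ (∀ β, 0 < a' β) ∧ Tendsto a atTop (𝓝 0) ∧ Tendsto a' atTop (𝓝 0) ∧
        OSLegsAtWeakCouplingC.Y2Bridge.UV G r a' ∧ OSLegsAtWeakCouplingC.Y2Bridge.ROT G r a' ∧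
        (∀ x : ℝ, ∃ β ∈ Bset, x ≤ β) ∧
        (∃ (c₁ β₂ : ℝ) (S₁ : ℝ → ℕ), 0 < c₁ ∧ ∀ A B : YMSpecies G, ∃ C : ℝ, ∀ β ∈ Bset, β₂ ≤ β →
          ∀ S n : ℕ, S₁ β ≤ S → n ≤ S →
            |latticeConnectedCorr r.ρ β (2 * S + 1) A.F B.F n| ≤ C * Real.exp (-(c₁ * a' β * n))) ∧
        0 < m₁ ∧ (∀ β ∈ Bset, m₁ ≤ a β / a' β ∧ a β / a' β ≤ m₂) ∧ 0 < σ ∧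
        tsupport (v : EuclideanSpace ℝ (Fin 4) → ℝ) ⊆ Metric.closedBall 0 σ ∧
        tsupport (f : EuclideanSpace ℝ (Fin 4) → ℝ) ⊆ Metric.closedBall 0 σ ∧
        tsupport (g : EuclideanSpace ℝ (Fin 4) → ℝ) ⊆ Metric.closedBall 0 σ ∧
        tsupport (h : EuclideanSpace ℝ (Fin 4) → ℝ) ⊆ Metric.closedBall 0 σ ∧
        0 < δ₀ ∧ (∀ p : EuclideanSpace ℝ (Fin 4), v p ≠ 0 → δ₀ ≤ p 0) ∧ 0 < δ ∧
        (∀ p q : EuclideanSpace ℝ (Fin 4), f p ≠ 0 → g q ≠ 0 → δ ≤ ‖p - q‖) ∧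
        (∀ p q : EuclideanSpace ℝ (Fin 4), g p ≠ 0 → h q ≠ 0 → δ ≤ ‖p - q‖) ∧
        (∀ p q : EuclideanSpace ℝ (Fin 4), f p ≠ 0 → h q ≠ 0 → δ ≤ ‖p - q‖) ∧
        0 < ε ∧ 0 < ε' ∧
        ∀ β ∈ Bset, ∀ Dd : ℕ, ∃ L : ℕ, Dd ≤ L ∧
          ε ≤ Q2 G r β L (a β) (thetaTest 4 v) v ∧ ε' ≤ |Q3 G r β L (a β) f g h|) :
    YangMills := by
  refine OSLegsAtWeakCouplingC.Y2Bridge.yangMills_of_subseqNTLegs fun G _ _ _ _ hG => ?_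
  letI : MeasurableSpace G := borel G
  haveI : BorelSpace G := ⟨rfl⟩
  obtain ⟨r, a, a', m₁, m₂, σ, δ₀, δ, ε, ε', Bset, v, f, g, h, hapos, ha'pos, hlim, hlim', hUV, hROT, hBcof, hIRon,
    hm₁, hratio, hσ, hvσ, hfσ, hgσ, hhσ, hδ₀, hv0, hδ, hfg, hgh, hfh, hε, hε', hfl⟩ := hyp G hG
  have hMB : MomentBounds G r a' :=
    Summit.QuantumFields.YangMills.Theorems.OSLegsFromFemtoAndGap.momentBounds_of_momentBounds6 r a' hUV
  obtain ⟨μ, hμI, D, hD, Bset', hsub, hcof', hfl'⟩ := subseqFloors_of_comparableUnit r ha'pos hlim hMB hBcof hm₁ hratio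
    hσ hvσ hfσ hgσ hhσ hδ₀ hv0 hδ hfg hgh hfh hε hε' hfl
  have hμ0 : 0 < μ := hm₁.trans_le hμI.1
  refine ⟨r, a', ha'pos, hlim', hUV, hROT, Bset', hcof',
    OSLegsAtWeakCouplingC.Y2Bridge.gapOn_mono r a' hsub hIRon,
    SchwartzMap.compCLMOfContinuousLinearEquiv ℝ D v, ε / 2, SchwartzMap.compCLMOfContinuousLinearEquiv ℝ D f,
    SchwartzMap.compCLMOfContinuousLinearEquiv ℝ D g, SchwartzMap.compCLMOfContinuousLinearEquiv ℝ D h, ε' / 2,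
    tsupport_compCLM_subset_pos D μ hD hμ0 (tsupport_subset_pos_of_gap hδ₀ hv0), by positivity,
    disjoint_tsupport_compCLM D (disjoint_tsupport_of_dist hδ hfg),
    disjoint_tsupport_compCLM D (disjoint_tsupport_of_dist hδ hgh),
    disjoint_tsupport_compCLM D (disjoint_tsupport_of_dist hδ hfh), by positivity, hfl'⟩


/-! ## §4 (appended) The IR family may be given at either of two comparable units -/

/-- **Clustering at unit `a` on `Bset` is clustering at any comparable unit `a'` on `Bset`** (rate `c₁ ↦ c₁ m₁` when
`m₁ ≤ aβ/a'β` there; the positivity of the new rate needs `m₁ > 0`, supplied by the caller): so in `yangMills_of_legs_comparableUnits` the `GapInUnits` family may equally be supplied at NT's unit. [folklore] -/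
theorem gapOn_of_comparableUnit {G : Type} [Group G] [TopologicalSpace G] [IsTopologicalGroup G] [CompactSpace G]
    [MeasurableSpace G] [BorelSpace G] (r : LatticeRep G) {a a' : ℝ → ℝ} (ha'pos : ∀ β, 0 < a' β)
    {Bset : Set ℝ} {m₁ : ℝ} (hratio : ∀ β ∈ Bset, m₁ ≤ a β / a' β)
    (h : ∃ (c₁ β₂ : ℝ) (S₁ : ℝ → ℕ), 0 < c₁ ∧ ∀ A B : YMSpecies G, ∃ C : ℝ, ∀ β ∈ Bset, β₂ ≤ β →
      ∀ S n : ℕ, S₁ β ≤ S → n ≤ S →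
        |latticeConnectedCorr r.ρ β (2 * S + 1) A.F B.F n| ≤ C * Real.exp (-(c₁ * a β * n))) :
    ∃ (c₁ β₂ : ℝ) (S₁ : ℝ → ℕ), 0 < c₁ ∧ ∀ A B : YMSpecies G, ∃ C : ℝ, ∀ β ∈ Bset, β₂ ≤ β →
      ∀ S n : ℕ, S₁ β ≤ S → n ≤ S →
        |latticeConnectedCorr r.ρ β (2 * S + 1) A.F B.F n| ≤ C * Real.exp (-(c₁ * m₁ * a' β * n)) := by
  obtain ⟨c₁, β₂, S₁, hc₁, hAB⟩ := h
  refine ⟨c₁, β₂, S₁, hc₁, fun A B => ?_⟩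
  obtain ⟨C, hC⟩ := hAB A B
  refine ⟨C, fun β hβ hβ₂ S n hS hn => (hC β hβ hβ₂ S n hS hn).trans ?_⟩
  have hC0 : 0 ≤ C := by
    have h0 := (abs_nonneg _).trans (hC β hβ hβ₂ S n hS hn)
    exact (mul_nonneg_iff_of_pos_right (Real.exp_pos _)).1 h0
  refine mul_le_mul_of_nonneg_left (Real.exp_le_exp.2 ?_) hC0
  have hr := hratio β hβ
  rw [le_div_iff₀ (ha'pos β)] at hr
  have hn0 : (0 : ℝ) ≤ n := Nat.cast_nonneg n
  nlinarith [mul_nonneg hc₁.le hn0]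

/-- **`yangMills_of_legs_comparableUnits` with `c₁ m₁` bookkeeping done**: the same statement with the `GapInUnits` family
supplied at NT's unit `a` instead of `a'`. [folklore] -/
theorem yangMills_of_legs_comparableUnits'
    (hyp : ∀ (G : Type) [Group G] [TopologicalSpace G] [IsTopologicalGroup G] [CompactSpace G],
      IsCompactSimpleLieGroup G → letI : MeasurableSpace G := borel G; haveI : BorelSpace G := ⟨rfl⟩;
      ∃ (r : LatticeRep G) (a a' : ℝ → ℝ) (m₁ m₂ σ δ₀ δ ε ε' : ℝ) (Bset : Set ℝ)
        (v f g h : 𝓢(EuclideanSpace ℝ (Fin 4), ℝ)),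
        (∀ β, 0 < a β) ∧ (∀ β, 0 < a' β) ∧ Tendsto a atTop (𝓝 0) ∧ Tendsto a' atTop (𝓝 0) ∧
        OSLegsAtWeakCouplingC.Y2Bridge.UV G r a' ∧ OSLegsAtWeakCouplingC.Y2Bridge.ROT G r a' ∧
        (∀ x : ℝ, ∃ β ∈ Bset, x ≤ β) ∧
        (∃ (c₁ β₂ : ℝ) (S₁ : ℝ → ℕ), 0 < c₁ ∧ ∀ A B : YMSpecies G, ∃ C : ℝ, ∀ β ∈ Bset, β₂ ≤ β →
          ∀ S n : ℕ, S₁ β ≤ S → n ≤ S →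
            |latticeConnectedCorr r.ρ β (2 * S + 1) A.F B.F n| ≤ C * Real.exp (-(c₁ * a β * n))) ∧
        0 < m₁ ∧ (∀ β ∈ Bset, m₁ ≤ a β / a' β ∧ a β / a' β ≤ m₂) ∧ 0 < σ ∧
        tsupport (v : EuclideanSpace ℝ (Fin 4) → ℝ) ⊆ Metric.closedBall 0 σ ∧
        tsupport (f : EuclideanSpace ℝ (Fin 4) → ℝ) ⊆ Metric.closedBall 0 σ ∧
        tsupport (g : EuclideanSpace ℝ (Fin 4) → ℝ) ⊆ Metric.closedBall 0 σ ∧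
        tsupport (h : EuclideanSpace ℝ (Fin 4) → ℝ) ⊆ Metric.closedBall 0 σ ∧
        0 < δ₀ ∧ (∀ p : EuclideanSpace ℝ (Fin 4), v p ≠ 0 → δ₀ ≤ p 0) ∧ 0 < δ ∧
        (∀ p q : EuclideanSpace ℝ (Fin 4), f p ≠ 0 → g q ≠ 0 → δ ≤ ‖p - q‖) ∧
        (∀ p q : EuclideanSpace ℝ (Fin 4), g p ≠ 0 → h q ≠ 0 → δ ≤ ‖p - q‖) ∧
        (∀ p q : EuclideanSpace ℝ (Fin 4), f p ≠ 0 → h q ≠ 0 → δ ≤ ‖p - q‖) ∧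
        0 < ε ∧ 0 < ε' ∧
        ∀ β ∈ Bset, ∀ Dd : ℕ, ∃ L : ℕ, Dd ≤ L ∧
          ε ≤ Q2 G r β L (a β) (thetaTest 4 v) v ∧ ε' ≤ |Q3 G r β L (a β) f g h|) :
    YangMills := by
  refine yangMills_of_legs_comparableUnits fun G _ _ _ _ hG => ?_
  letI : MeasurableSpace G := borel G
  haveI : BorelSpace G := ⟨rfl⟩
  obtain ⟨r, a, a', m₁, m₂, σ, δ₀, δ, ε, ε', Bset, v, f, g, h, hapos, ha'pos, hlim, hlim', hUV, hROT, hBcof, hIRon,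
    hm₁, hratio, rest⟩ := hyp G hG
  obtain ⟨c₁, β₂, S₁, hc₁, hAB⟩ := gapOn_of_comparableUnit r ha'pos (fun β hβ => (hratio β hβ).1) hIRon
  refine ⟨r, a, a', m₁, m₂, σ, δ₀, δ, ε, ε', Bset, v, f, g, h, hapos, ha'pos, hlim, hlim', hUV, hROT, hBcof,
    ⟨c₁ * m₁, β₂, S₁, mul_pos hc₁ hm₁, hAB⟩, hm₁, hratio, rest⟩

end Summit.QuantumFields.YangMills.Cruxes.NT.Subsequential

end
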